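import Mathlib.Analysis.Distribution.AEEqOfIntegralContDiff
import Mathlib.MeasureTheory.Function.LocallyIntegrable
import Literature.Analysis.FluidPDE.AxisymmetricEuler
import Summits.NavierStokesRegularity.NavierStokesRegularity.Theorems.L3TimeExponentPincerEquivariantLimit
import HarnessLib.Audit
import HarnessLib

/-!
# L3TimeExponentPincer — absence of swirl passes to distributional limits

Support kernel for the crux `L3CascadeJaw` (item stmt-NavierStokesRegularity-19499) of route
`L3TimeExponentPincer`; third symmetry input of the compactness step (J) of planner nsreg-p2's
ROUND-12 §2b (`CritSmoothingNoSwirlB ⇐ (SFL³)`), after `…RecedingAxis` (receding axes: limit `0`)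
and `…ConvergingAxes` (converging axes: limit axisymmetric): the swirl about the limit axis of the
limit field vanishes.

The swirl of `v` about the vertical axis through `a` is the scalar
`Γ_a v (x) = (x - a)₀ v₁(x) - (x - a)₁ v₀(x)` (`= Literature.Analysis.FluidPDE.swirl` of the
translate, `swirlAbout_eq_swirl_translate`); it is LINEAR in `v` with coefficients continuous in
`(x, a)`, so no equivariance argument is needed:

* `integral_smul_apply_eq` — components of the vector integrals `∫ g • v` are the scalar
  integrals `∫ g v_i`;
* `tendsto_integral_mul_swirlAbout` — if `∫ g • v_k → ∫ g • v` for all `g ∈ C_c^∞(ℝ³; ℝ)` and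
  `a_k → a`, then `∫ g Γ_{a_k} v_k → ∫ g Γ_a v` for all such `g`;
* **`ae_swirlAbout_eq_zero_of_tendsto`** — if moreover `Γ_{a_k} v_k = 0` (each `v_k` swirl-free
  about its axis) and `v` is locally integrable, then `Γ_a v = 0` a.e.

WHAT THIS IS NOT: not NS regularity or blow-up; linear bookkeeping; the crux `L3CascadeJaw` is
untouched; no crux claim.
-/

noncomputable section

open MeasureTheory Set Function Filter Topology Metric WithLp
open scoped ENNReal NNReal ContDiff

namespace Summit.NavierStokesRegularity.NavierStokesRegularity.Theorems.L3TimeExponentPincerSwirlFreeLimit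

open Literature.Analysis.FluidPDE
open Summit.NavierStokesRegularity.NavierStokesRegularity.Theorems.L3TimeExponentPincerEquivariantLimit

/-- The swirl of `v` about the vertical axis through `a`:
`Γ_a v (x) = (x - a)₀ v₁(x) - (x - a)₁ v₀(x)`.  (A `theorem`-free abbreviation would be a
definition; we keep the expression explicit in all statements and only name it in docstrings.)
This lemma records that it is the tree's `swirl` of the translated field at the translated point. -/
theorem swirlAbout_eq_swirl_translate (v : EuclideanSpace ℝ (Fin 3) → EuclideanSpace ℝ (Fin 3))
    (a x : EuclideanSpace ℝ (Fin 3)) :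
    (x - a) 0 * v x 1 - (x - a) 1 * v x 0 = swirl (fun y => v (y + a)) (x - a) := by
  simp [swirl, sub_add_cancel]

/-- Components of the vector integral `∫ g • v` are the scalar integrals `∫ g · v_i`. -/
theorem integral_smul_apply_eq {g : EuclideanSpace ℝ (Fin 3) → ℝ}
    {v : EuclideanSpace ℝ (Fin 3) → EuclideanSpace ℝ (Fin 3)}
    (hint : Integrable (fun x => g x • v x)) (i : Fin 3) :
    (∫ x, g x • v x) i = ∫ x, g x * v x i := by
  have h := (ContinuousLinearMap.integral_comp_comm (EuclideanSpace.proj i) hint).symm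
  simp only [PiLp.proj_apply] at h
  simpa [smul_eq_mul] using h

/-- **Swirl integrals pass to the limit along converging axes.**  If `∫ g • v_k → ∫ g • v` for
every `g ∈ C_c^∞(ℝ³; ℝ)`, the `v_k` and `v` are locally integrable, and `a_k → a`, then for
every such `g`, `∫ g Γ_{a_k} v_k → ∫ g Γ_a v`. -/
theorem tendsto_integral_mul_swirlAbout
    {v : ℕ → EuclideanSpace ℝ (Fin 3) → EuclideanSpace ℝ (Fin 3)}
    {vl : EuclideanSpace ℝ (Fin 3) → EuclideanSpace ℝ (Fin 3)} {a : ℕ → EuclideanSpace ℝ (Fin 3)}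
    {al : EuclideanSpace ℝ (Fin 3)} (ha : Tendsto a atTop (𝓝 al))
    (hv : ∀ k, LocallyIntegrable (v k) volume) (hvl : LocallyIntegrable vl volume)
    (hconv : ∀ g : EuclideanSpace ℝ (Fin 3) → ℝ, ContDiff ℝ ∞ g → HasCompactSupport g →
      Tendsto (fun k => ∫ x, g x • v k x) atTop (𝓝 (∫ x, g x • vl x)))
    {g : EuclideanSpace ℝ (Fin 3) → ℝ} (hg : ContDiff ℝ ∞ g) (hgs : HasCompactSupport g) :
    Tendsto (fun k => ∫ x, g x * ((x - a k) 0 * v k x 1 - (x - a k) 1 * v k x 0)) atTop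
      (𝓝 (∫ x, g x * ((x - al) 0 * vl x 1 - (x - al) 1 * vl x 0))) := by
  -- the two coordinate test functions `g · (x - al)_j` and the integrals they produce
  have hcoord : ∀ j : Fin 3, ContDiff ℝ ∞ (fun x : EuclideanSpace ℝ (Fin 3) => x j) := fun j =>
    (EuclideanSpace.proj (𝕜 := ℝ) (ι := Fin 3) j).contDiff
  have hgj : ∀ j : Fin 3, ContDiff ℝ ∞ (fun x => g x * (x - al) j) := fun j => by
    simpa only [PiLp.sub_apply] using hg.mul ((hcoord j).sub (contDiff_const (c := al j)))
  have hgjs : ∀ j : Fin 3, HasCompactSupport (fun x => g x * (x - al) j) := fun j =>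
    hgs.mul_right
  -- integrability of the products
  have hI : ∀ (w : EuclideanSpace ℝ (Fin 3) → EuclideanSpace ℝ (Fin 3)),
      LocallyIntegrable w volume → ∀ (h : EuclideanSpace ℝ (Fin 3) → ℝ), ContDiff ℝ ∞ h →
      HasCompactSupport h → Integrable (fun x => h x • w x) := fun w hw h hh hhs =>
    hw.integrable_smul_left_of_hasCompactSupport hh.continuous hhs
  -- pointwise algebra: `g Γ_b w = (g (x-al)₀) w₁ - (g (x-al)₁) w₀ + (al - b)₀ (g w₁) - (al - b)₁ (g w₀)`
  have hsplit : ∀ (w : EuclideanSpace ℝ (Fin 3) → EuclideanSpace ℝ (Fin 3)) (b x : EuclideanSpace ℝ (Fin 3)),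
      g x * ((x - b) 0 * w x 1 - (x - b) 1 * w x 0)
        = (g x * (x - al) 0) * w x 1 - (g x * (x - al) 1) * w x 0
          + ((al - b) 0 * (g x * w x 1) - (al - b) 1 * (g x * w x 0)) := by
    intro w b x
    simp only [PiLp.sub_apply]
    ring
  -- the four scalar sequences converge
  have hT : ∀ (h : EuclideanSpace ℝ (Fin 3) → ℝ), ContDiff ℝ ∞ h → HasCompactSupport h → ∀ i : Fin 3,
      Tendsto (fun k => ∫ x, h x * v k x i) atTop (𝓝 (∫ x, h x * vl x i)) := by
    intro h hh hhs i
    have h1 := ((EuclideanSpace.proj i).continuous.tendsto _).comp (hconv h hh hhs)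
    have e1 : ∀ k, (EuclideanSpace.proj i) (∫ x, h x • v k x) = ∫ x, h x * v k x i := fun k => by
      rw [← integral_smul_apply_eq (hI _ (hv k) h hh hhs) i]; rfl
    have e2 : (EuclideanSpace.proj i) (∫ x, h x • vl x) = ∫ x, h x * vl x i := by
      rw [← integral_smul_apply_eq (hI _ hvl h hh hhs) i]; rfl
    simpa only [Function.comp_def, e1, e2] using h1
  have hab : Tendsto (fun k => al - a k) atTop (𝓝 0) := by
    simpa using (tendsto_const_nhds (x := al)).sub ha
  have hab_j : ∀ j : Fin 3, Tendsto (fun k => (al - a k) j) atTop (𝓝 0) := fun j => by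
    have h1 := (((EuclideanSpace.proj (𝕜 := ℝ) (ι := Fin 3) j).continuous.tendsto 0).comp hab)
    simpa [Function.comp_def] using h1
  -- rewrite both sides with `hsplit` and integrate termwise
  have hIc : ∀ (w : EuclideanSpace ℝ (Fin 3) → EuclideanSpace ℝ (Fin 3)),
      LocallyIntegrable w volume → ∀ (h : EuclideanSpace ℝ (Fin 3) → ℝ), ContDiff ℝ ∞ h →
      HasCompactSupport h → ∀ i : Fin 3, Integrable (fun x => h x * w x i) := by
    intro w hw h hh hhs i
    have h1 := (locallyIntegrable_clm_comp hw (EuclideanSpace.proj (𝕜 := ℝ) (ι := Fin 3) i)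
      ).integrable_smul_left_of_hasCompactSupport hh.continuous hhs
    simpa [smul_eq_mul] using h1
  have hint_k : ∀ k (j i : Fin 3), Integrable (fun x => (g x * (x - al) j) * v k x i) :=
    fun k j i => hIc (v k) (hv k) _ (hgj j) (hgjs j) i
  have hint_l : ∀ (j i : Fin 3), Integrable (fun x => (g x * (x - al) j) * vl x i) :=
    fun j i => hIc vl hvl _ (hgj j) (hgjs j) i
  have hintg_k : ∀ k (i : Fin 3), Integrable (fun x => g x * v k x i) :=
    fun k i => hIc (v k) (hv k) g hg hgs i
  have hintg_l : ∀ (i : Fin 3), Integrable (fun x => g x * vl x i) :=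
    fun i => hIc vl hvl g hg hgs i
  have ek : ∀ k, ∫ x, g x * ((x - a k) 0 * v k x 1 - (x - a k) 1 * v k x 0)
      = (∫ x, (g x * (x - al) 0) * v k x 1) - (∫ x, (g x * (x - al) 1) * v k x 0)
        + ((al - a k) 0 * (∫ x, g x * v k x 1) - (al - a k) 1 * (∫ x, g x * v k x 0)) := by
    intro k
    have hAB : Integrable (fun x => (g x * (x - al) 0) * v k x 1 - (g x * (x - al) 1) * v k x 0) :=
      (hint_k k 0 1).sub (hint_k k 1 0)
    have hC : Integrable (fun x => (al - a k) 0 * (g x * v k x 1)) := (hintg_k k 1).const_mul _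
    have hD : Integrable (fun x => (al - a k) 1 * (g x * v k x 0)) := (hintg_k k 0).const_mul _
    have hCD : Integrable (fun x => (al - a k) 0 * (g x * v k x 1) - (al - a k) 1 * (g x * v k x 0)) :=
      hC.sub hD
    simp_rw [hsplit (v k) (a k)]
    rw [integral_add hAB hCD, integral_sub (hint_k k 0 1) (hint_k k 1 0), integral_sub hC hD,
      integral_const_mul, integral_const_mul]
  have el : ∫ x, g x * ((x - al) 0 * vl x 1 - (x - al) 1 * vl x 0)
      = (∫ x, (g x * (x - al) 0) * vl x 1) - (∫ x, (g x * (x - al) 1) * vl x 0)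
        + ((al - al) 0 * (∫ x, g x * vl x 1) - (al - al) 1 * (∫ x, g x * vl x 0)) := by
    have hAB : Integrable (fun x => (g x * (x - al) 0) * vl x 1 - (g x * (x - al) 1) * vl x 0) :=
      (hint_l 0 1).sub (hint_l 1 0)
    have hC : Integrable (fun x => (al - al) 0 * (g x * vl x 1)) := (hintg_l 1).const_mul _
    have hD : Integrable (fun x => (al - al) 1 * (g x * vl x 0)) := (hintg_l 0).const_mul _
    have hCD : Integrable (fun x => (al - al) 0 * (g x * vl x 1) - (al - al) 1 * (g x * vl x 0)) :=
      hC.sub hD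
    simp_rw [hsplit vl al]
    rw [integral_add hAB hCD, integral_sub (hint_l 0 1) (hint_l 1 0), integral_sub hC hD,
      integral_const_mul, integral_const_mul]
  rw [el]
  simp only [sub_self, PiLp.zero_apply, zero_mul]
  refine Tendsto.congr (fun k => (ek k).symm) ?_
  have h1 := ((hT _ (hgj 0) (hgjs 0) 1).sub (hT _ (hgj 1) (hgjs 1) 0)).add
    (((hab_j 0).mul (hT g hg hgs 1)).sub ((hab_j 1).mul (hT g hg hgs 0)))
  simpa using h1

/-- **Absence of swirl passes to distributional limits along converging axes.**  If each `v_k` is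
swirl-free about the vertical axis through `a_k` (`Γ_{a_k} v_k = 0` pointwise), `a_k → a`,
`v_k → v` against every `g ∈ C_c^∞(ℝ³; ℝ)`, all fields locally integrable, then `Γ_a v = 0` a.e. -/
theorem ae_swirlAbout_eq_zero_of_tendsto
    {v : ℕ → EuclideanSpace ℝ (Fin 3) → EuclideanSpace ℝ (Fin 3)}
    {vl : EuclideanSpace ℝ (Fin 3) → EuclideanSpace ℝ (Fin 3)} {a : ℕ → EuclideanSpace ℝ (Fin 3)}
    {al : EuclideanSpace ℝ (Fin 3)}
    (hsw : ∀ k x, (x - a k) 0 * v k x 1 - (x - a k) 1 * v k x 0 = 0)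
    (ha : Tendsto a atTop (𝓝 al))
    (hv : ∀ k, LocallyIntegrable (v k) volume) (hvl : LocallyIntegrable vl volume)
    (hconv : ∀ g : EuclideanSpace ℝ (Fin 3) → ℝ, ContDiff ℝ ∞ g → HasCompactSupport g →
      Tendsto (fun k => ∫ x, g x • v k x) atTop (𝓝 (∫ x, g x • vl x))) :
    ∀ᵐ x ∂volume, (x - al) 0 * vl x 1 - (x - al) 1 * vl x 0 = 0 := by
  -- the limit swirl is locally integrable
  have hcomp : ∀ i : Fin 3, LocallyIntegrable (fun x => vl x i) volume := fun i =>
    locallyIntegrable_clm_comp hvl (EuclideanSpace.proj i)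
  have hcoordc : ∀ j : Fin 3, Continuous (fun x : EuclideanSpace ℝ (Fin 3) => (x - al) j) := fun j => by
    fun_prop
  have hLI : LocallyIntegrable (fun x => (x - al) 0 * vl x 1 - (x - al) 1 * vl x 0) volume := by
    rw [MeasureTheory.locallyIntegrable_iff]
    intro K hK
    exact (((hcomp 1).integrableOn_isCompact hK).continuousOn_mul (hcoordc 0).continuousOn hK).sub
      (((hcomp 0).integrableOn_isCompact hK).continuousOn_mul (hcoordc 1).continuousOn hK)
  refine ae_eq_zero_of_integral_contDiff_smul_eq_zero hLI fun g hg hgs => ?_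
  have hlim := tendsto_integral_mul_swirlAbout ha hv hvl hconv hg hgs
  have hzero : (fun k => ∫ x, g x * ((x - a k) 0 * v k x 1 - (x - a k) 1 * v k x 0)) = fun _ => 0 := by
    funext k
    have h1 : (fun x => g x * ((x - a k) 0 * v k x 1 - (x - a k) 1 * v k x 0)) = fun _ => 0 := by
      funext x
      rw [hsw k x, mul_zero]
    rw [h1, integral_zero]
  rw [hzero] at hlim
  have h0 : ∫ x, g x * ((x - al) 0 * vl x 1 - (x - al) 1 * vl x 0) = 0 :=
    tendsto_nhds_unique hlim tendsto_const_nhds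
  simpa only [smul_eq_mul] using h0

end Summit.NavierStokesRegularity.NavierStokesRegularity.Theorems.L3TimeExponentPincerSwirlFreeLimit

end
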